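/-
Origin: expansion seat `planner-pub-hodgecm-toy-g2-0`, handover #37 2026-08-18T10:43:10Z (`HOME/pub-hodgecm-toy-g2/lean/ToyG2/EigenSplit.lean`, md5 429890f7, 209 lines);
landed by the gen-7 packager in gate run 28 as `HodgeCM/Model/ToyG2/EigenSplit.lean` (import ^import ToyG2\.→import HodgeCM.Model.ToyG2. ×1).
-/
/-
Copyright: pub-hodgecm cell, lineage pub-hodgecm-toy (generation 2). Explicit-model track (referee A, G4).

# Semisimplicity from a complex eigenbasis (file #37)

The last structural input of the `RightSplit` engine (`SplitEngine.lean`) is the semisimplicity of the rational operator `T` on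
`⋀ʲ H¹X`.  This file proves it from the data generation 3 actually has — a complex basis of `⋀ʲ_ℂ` on which the
complexification `TC X j T` is diagonal:

* `eq_zero_of_one_tmul_eq_zero`, `eq_zero_of_baseChange_eq_zero`: `w ↦ 1 ⊗ w` and `T ↦ T ⊗ ℂ` are injective on `⋀ʲ H¹X`
  (through the functionals `baseC`);
* **`isSemisimple_of_eigenbasis`**: if `TC X j T` is diagonal in some complex basis then `T` is semisimple over `ℚ`
  (Jordan–Chevalley over the perfect field `ℚ`, Mathlib `Module.End.exists_isNilpotent_isSemisimple`: the nilpotent part lies in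
  `ℚ[T]`, hence is diagonal after `ℂ ⊗ -`, hence has nilpotent — so zero — eigenvalues, hence vanishes);
* **`rightSplit_of_eigenbasis`** / **`hodgeRiesz_of_eigenbasis`**: `RightSplit` (hence Hodge–Riesz, file #34) from a common
  eigenbasis of `TC X j T` and of the weight operators whose weight eigenvalue is a function of the `T`-eigenvalue, plus
  `T`-stability of the right radical;
* `map_basis_of_diag`, `TC_map`, **`rightSplit_of_diag`** / **`hodgeRiesz_of_diag`**: the case generation 3 needs — `T = ⋀ʲ g` for a
  rational `g` (a CM multiplication) with `g ⊗ ℂ` diagonal on the eigenbasis `eB` (eigen-monomial basis `eB.exteriorPower j`,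
  `wt_basis`): it remains to check that the product eigenvalue determines the holomorphic count (`hsep`, arithmetic of the
  chosen `g`) and that `⋀ʲ g` preserves the right radical (`hR`, via `trRightRad_map_mem`: trace semi-invariance);
* `TC_add`, `TC_comp`, `TC_smul`, `TC_id`: so that `T` may also be taken as a rational combination of products of several `⋀ʲ gₖ`
  (still diagonal on `eB.exteriorPower j`, eigenvalue the same combination of the product eigenvalues; use
  `rightSplit_of_eigenbasis` with that eigenvalue function and `trRightRad_invariant_add` / `_comp` for `hR`) — a generic
  combination separates all index sets `S`, which makes `hsep` automatic.

0 placeholders; axioms `[propext, Classical.choice, Quot.sound]`.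
-/
import Mathlib
import Summits.HodgeConjecture.HodgeCM.Model.ToyG2.SplitEngine

/-! PORT of `HodgeCM/Model/ToyG2/EigenSplit.lean` (HodgeCMPerL run 82) — verbatim mechanical port; provenance in the PORT header line. -/

namespace HodgeCM.ToyG2

open HodgeCM.Toy HodgeCM.Toy.CMPresentation
open Literature.AlgebraicGeometry.Motives
open scoped TensorProduct
open exteriorPower Obj₂

noncomputable section

variable {X : Obj₂} {j : ℕ}

/-- `w ↦ 1 ⊗ w` is injective on `⋀ʲ H¹X` -/
theorem eq_zero_of_one_tmul_eq_zero (w : ⋀[ℚ]^j X.L) (h : (1 : ℂ) ⊗ₜ[ℚ] w = 0) : w = 0 := by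
  haveI : Module.Free ℚ (↥(⋀[ℚ]^j X.L)) := Module.Free.of_divisionRing ℚ _
  refine (Module.forall_dual_apply_eq_zero_iff ℚ w).1 fun φ => ?_
  have h1 := baseC_theta_one_tmul X.toObj φ w
  rw [h, map_zero, map_zero] at h1
  exact_mod_cast h1.symm

/-- base change along `ℚ → ℂ` is injective on endomorphisms of `⋀ʲ H¹X` -/
theorem eq_zero_of_baseChange_eq_zero (n : ⋀[ℚ]^j X.L →ₗ[ℚ] ⋀[ℚ]^j X.L) (h : n.baseChange ℂ = 0) : n = 0 := by
  refine LinearMap.ext fun w => ?_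
  have h1 : (1 : ℂ) ⊗ₜ[ℚ] n w = 0 := by
    rw [← LinearMap.baseChange_tmul, h, LinearMap.zero_apply]
  rw [LinearMap.zero_apply]
  exact eq_zero_of_one_tmul_eq_zero (n w) h1

set_option maxHeartbeats 1600000 in
/-- **semisimplicity from a complex eigenbasis**: if the complexification `TC X j T` is diagonal in some basis of `⋀ʲ_ℂ`, then
`T` is a semisimple endomorphism of `⋀ʲ H¹X` over `ℚ`. -/
theorem isSemisimple_of_eigenbasis {ι : Type*} (T : ⋀[ℚ]^j X.L →ₗ[ℚ] ⋀[ℚ]^j X.L)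
    (b : Module.Basis ι ℂ (⋀[ℂ]^j X.toObj.LC)) (lam : ι → ℂ) (hT : ∀ i, TC X j T (b i) = lam i • b i) :
    Module.End.IsSemisimple T := by
  haveI : Module.Free ℚ (↥(⋀[ℚ]^j X.L)) := Module.Free.of_divisionRing ℚ _
  haveI : Module.Finite ℚ (↥(⋀[ℚ]^j X.L)) := exteriorPower.instFinite
  let b' : Module.Basis ι ℂ (ℂ ⊗[ℚ] ↥(⋀[ℚ]^j X.L)) := b.map (X.toObj.Θ j).symm
  have hb' : ∀ i, b' i = (X.toObj.Θ j).symm (b i) := fun i => by simp [b']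
  have hdiag : ∀ x ∈ Algebra.adjoin ℚ ({T} : Set (Module.End ℚ ↥(⋀[ℚ]^j X.L))),
      ∀ i, ∃ c : ℂ, x.baseChange ℂ (b' i) = c • b' i := by
    intro x hx
    refine Algebra.adjoin_induction (p := fun x _ => ∀ i, ∃ c : ℂ, x.baseChange ℂ (b' i) = c • b' i)
      ?_ ?_ ?_ ?_ hx
    · intro x hx i
      rw [Set.mem_singleton_iff] at hx
      rw [hx]
      refine ⟨lam i, ?_⟩
      have h1 : X.toObj.Θ j (T.baseChange ℂ ((X.toObj.Θ j).symm (b i))) = lam i • b i := hT i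
      have h2 : T.baseChange ℂ ((X.toObj.Θ j).symm (b i)) = (X.toObj.Θ j).symm (lam i • b i) := by
        rw [LinearEquiv.eq_symm_apply]; exact h1
      rw [hb', h2, map_smul]
    · intro q i
      refine ⟨(q : ℂ), ?_⟩
      rw [Algebra.algebraMap_eq_smul_one, LinearMap.baseChange_smul, LinearMap.baseChange_one, LinearMap.smul_apply,
        Module.End.one_apply, ← algebraMap_smul ℂ q (b' i), eq_ratCast]
    · intro x y _ _ hx hy i
      obtain ⟨c, hc⟩ := hx i
      obtain ⟨d, hd⟩ := hy i
      exact ⟨c + d, by rw [LinearMap.baseChange_add, LinearMap.add_apply, hc, hd, add_smul]⟩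
    · intro x y _ _ hx hy i
      obtain ⟨c, hc⟩ := hx i
      obtain ⟨d, hd⟩ := hy i
      exact ⟨c * d, by rw [LinearMap.baseChange_mul, Module.End.mul_apply, hd, map_smul, hc, smul_smul, mul_comm]⟩
  obtain ⟨n, hn, s, -, hnil, hss, hTs⟩ := Module.End.exists_isNilpotent_isSemisimple (f := T)
  have hn0 : n = 0 := by
    obtain ⟨k, hk⟩ := hnil
    choose c hc using hdiag n hn
    have hck : ∀ i, c i = 0 := by
      intro i
      have hit : ∀ m : ℕ, (n ^ m).baseChange ℂ (b' i) = c i ^ m • b' i := by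
        intro m
        induction m with
        | zero => rw [pow_zero, LinearMap.baseChange_one, Module.End.one_apply, pow_zero, one_smul]
        | succ m ih =>
            rw [pow_succ, LinearMap.baseChange_mul, Module.End.mul_apply, hc, map_smul, ih, smul_smul, ← pow_succ']
      have h0 : c i ^ k • b' i = 0 := by
        rw [← hit k, hk, LinearMap.baseChange_zero, LinearMap.zero_apply]
      exact IsNilpotent.eq_zero ⟨k, (smul_eq_zero.1 h0).resolve_right (b'.ne_zero i)⟩
    apply eq_zero_of_baseChange_eq_zero
    refine b'.ext fun i => ?_
    rw [hc i, hck i, zero_smul, LinearMap.zero_apply]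
  rw [hTs, hn0, zero_add]
  exact hss

/-- **`RightSplit` from a common eigenbasis**: `TC X j T` and all weight operators diagonal in one complex basis, the weight
eigenvalue a function of the `T`-eigenvalue, and the right radical `T`-stable. -/
theorem rightSplit_of_eigenbasis {ι : Type*} [Fintype ι] (T : ⋀[ℚ]^j X.L →ₗ[ℚ] ⋀[ℚ]^j X.L)
    (b : Module.Basis ι ℂ (⋀[ℂ]^j X.toObj.LC)) (lam : ι → ℂ) (mu : ℂ → ι → ℂ)
    (hT : ∀ i, TC X j T (b i) = lam i • b i) (hS : ∀ z i, X.toObj.wt z j (b i) = mu z i • b i)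
    (h : ∀ z i i', lam i = lam i' → mu z i = mu z i')
    (hR : ∀ x ∈ trRightRad X 4 j, T x ∈ trRightRad X 4 j) : ∃ W, RightSplit X j W :=
  rightSplit_of_isSemisimple T (isSemisimple_of_eigenbasis T b lam hT) hR fun z =>
    exists_aeval_eq_of_eigenbasis b (TC X j T) (X.toObj.wt z j) lam (mu z) hT (hS z) (h z)

/-- … hence Hodge–Riesz for a good object with such an operator in the complementary degree -/
theorem hodgeRiesz_of_eigenbasis (hX : X.Good) {ι : Type*} [Fintype ι]
    (T : ⋀[ℚ]^(2 * (X.dim - 2)) X.L →ₗ[ℚ] ⋀[ℚ]^(2 * (X.dim - 2)) X.L)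
    (b : Module.Basis ι ℂ (⋀[ℂ]^(2 * (X.dim - 2)) X.toObj.LC)) (lam : ι → ℂ) (mu : ℂ → ι → ℂ)
    (hT : ∀ i, TC X _ T (b i) = lam i • b i) (hS : ∀ z i, X.toObj.wt z _ (b i) = mu z i • b i)
    (h : ∀ z i i', lam i = lam i' → mu z i = mu z i')
    (hR : ∀ x ∈ trRightRad X 4 (2 * (X.dim - 2)), T x ∈ trRightRad X 4 (2 * (X.dim - 2))) : HodgeRiesz X := by
  obtain ⟨W, hW⟩ := rightSplit_of_eigenbasis T b lam mu hT hS h hR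
  exact hodgeRiesz_of_rightSplit hX W hW

/-! ### `TC` is a ring map (for building `T` as a rational combination of products of `⋀ʲ gₖ`) -/

/-- (Ported verbatim from the HodgeCMPerL package; no docstring in the source.) -/
theorem TC_add (S T : ⋀[ℚ]^j X.L →ₗ[ℚ] ⋀[ℚ]^j X.L) : TC X j (S + T) = TC X j S + TC X j T := by
  simp only [TC, LinearMap.baseChange_add, LinearMap.comp_add, LinearMap.add_comp]

/-- (Ported verbatim from the HodgeCMPerL package; no docstring in the source.) -/
theorem TC_comp (S T : ⋀[ℚ]^j X.L →ₗ[ℚ] ⋀[ℚ]^j X.L) : TC X j (S ∘ₗ T) = TC X j S ∘ₗ TC X j T := by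
  refine LinearMap.ext fun v => ?_
  simp only [TC, LinearMap.baseChange_comp, LinearMap.coe_comp, Function.comp_apply, LinearEquiv.coe_coe,
    LinearEquiv.symm_apply_apply]

/-- (Ported verbatim from the HodgeCMPerL package; no docstring in the source.) -/
theorem TC_smul (q : ℚ) (T : ⋀[ℚ]^j X.L →ₗ[ℚ] ⋀[ℚ]^j X.L) : TC X j (q • T) = (q : ℂ) • TC X j T := by
  refine LinearMap.ext fun v => ?_
  simp only [TC, LinearMap.baseChange_smul, LinearMap.coe_comp, Function.comp_apply, LinearEquiv.coe_coe,
    LinearMap.smul_apply]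
  rw [← algebraMap_smul ℂ q (T.baseChange ℂ ((X.toObj.Θ j).symm v)), map_smul, eq_ratCast]

/-- (Ported verbatim from the HodgeCMPerL package; no docstring in the source.) -/
theorem TC_id : TC X j LinearMap.id = LinearMap.id := by
  refine LinearMap.ext fun v => ?_
  simp only [TC, LinearMap.baseChange_id, LinearMap.coe_comp, Function.comp_apply, LinearEquiv.coe_coe,
    LinearMap.id_apply, LinearEquiv.apply_symm_apply]

/-! ### The eigen-monomial basis: `T = ⋀ʲ g` for a rational `g` diagonal on the eigenbasis `eB` -/

/-- `⋀ᵏ φ` is diagonal on the eigen-monomial basis when `φ` is diagonal on the eigenbasis `eB` -/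
theorem map_basis_of_diag (A : Obj) (k : ℕ) (φ : A.LC →ₗ[ℂ] A.LC) (a : A.Idx → ℂ)
    (hφ : ∀ s, φ (A.eB s) = a s • A.eB s) (S : Set.powersetCard A.Idx k) :
    map k φ (A.eB.exteriorPower k S) = (∏ i, a (enum A S i)) • A.eB.exteriorPower k S := by
  rw [basis_eq_mono A S, Obj.map_mono]
  have h : (fun i => φ (A.eB (enum A S i))) = fun i => a (enum A S i) • A.eB (enum A S i) :=
    funext fun i => hφ _
  rw [h, AlternatingMap.map_smul_univ]
  rfl

/-- `TC` of `⋀ʲ g` is `⋀ʲ (g ⊗ ℂ)` -/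
theorem TC_map (g : X.L →ₗ[ℚ] X.L) : TC X j (map j g) = map j (g.baseChange ℂ) := by
  haveI : Module.Free ℚ X.L := Module.Free.of_divisionRing ℚ _
  let bQ := Module.finBasis ℚ X.L
  refine exteriorPower.linearMap_ext ?_
  refine Module.Basis.ext_alternating (Algebra.TensorProduct.basis ℂ bQ) fun v _ => ?_
  simp only [LinearMap.compAlternatingMap_apply, Algebra.TensorProduct.basis_apply]
  rw [map_apply_ιMulti]
  have h2 : (⇑(g.baseChange ℂ) ∘ fun i => (1 : ℂ) ⊗ₜ[ℚ] bQ (v i)) = fun i => (1 : ℂ) ⊗ₜ[ℚ] g (bQ (v i)) :=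
    funext fun i => by simp [LinearMap.baseChange_tmul]
  rw [h2, ιMulti_one_tmul X.toObj (fun i => bQ (v i)), ιMulti_one_tmul X.toObj (fun i => g (bQ (v i))), TC_theta,
    map_apply_ιMulti]
  rfl

/-- **`RightSplit` from a rational `g` diagonal on the eigenbasis**: `T = ⋀ʲ g` with `g ⊗ ℂ` diagonal on `eB`
(eigenvalues `a`), the product eigenvalue `∏_{s ∈ S} a s` determining the holomorphic count of `S`, and the right radical
`⋀ʲ g`-stable. -/
theorem rightSplit_of_diag (g : X.L →ₗ[ℚ] X.L) (a : X.toObj.Idx → ℂ)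
    (hg : ∀ s, g.baseChange ℂ (X.toObj.eB s) = a s • X.toObj.eB s)
    (hsep : ∀ S S' : Set.powersetCard X.toObj.Idx j,
      (∏ i, a (enum X.toObj S i)) = (∏ i, a (enum X.toObj S' i)) → X.toObj.nhol S.val = X.toObj.nhol S'.val)
    (hR : ∀ x ∈ trRightRad X 4 j, map j g x ∈ trRightRad X 4 j) : ∃ W, RightSplit X j W :=
  rightSplit_of_eigenbasis (map j g) (X.toObj.eB.exteriorPower j) (fun S => ∏ i, a (enum X.toObj S i))
    (fun z S => z ^ X.toObj.nhol S.val)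
    (fun S => by rw [TC_map]; exact map_basis_of_diag X.toObj j _ a hg S)
    (fun z S => X.toObj.wt_basis z j S)
    (fun z S S' h => by rw [hsep S S' h])
    hR

/-- … hence Hodge–Riesz for a good object with such a `g` in the complementary degree `j = 2·(dim − 2)` -/
theorem hodgeRiesz_of_diag (hX : X.Good) (g : X.L →ₗ[ℚ] X.L) (a : X.toObj.Idx → ℂ)
    (hg : ∀ s, g.baseChange ℂ (X.toObj.eB s) = a s • X.toObj.eB s)
    (hsep : ∀ S S' : Set.powersetCard X.toObj.Idx (2 * (X.dim - 2)),
      (∏ i, a (enum X.toObj S i)) = (∏ i, a (enum X.toObj S' i)) → X.toObj.nhol S.val = X.toObj.nhol S'.val)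
    (hR : ∀ x ∈ trRightRad X 4 (2 * (X.dim - 2)), map (2 * (X.dim - 2)) g x ∈ trRightRad X 4 (2 * (X.dim - 2))) :
    HodgeRiesz X := by
  obtain ⟨W, hW⟩ := rightSplit_of_diag g a hg hsep hR
  exact hodgeRiesz_of_rightSplit hX W hW

end

end HodgeCM.ToyG2
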